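import Mathlib.AlgebraicGeometry.AlgClosed.Basic
import Literature.AlgebraicGeometry.Morphisms.LocallyNoetherianLocallyConnected
import HarnessLib

/-!
# Every connected component of a scheme locally of finite type over an algebraically closed field has a rational point

Topic: `Literature/AlgebraicGeometry/Morphisms` (sequel of `LocallyNoetherianLocallyConnected`).  Let `K` be an
algebraically closed field and `f : X → Spec K` locally of finite type.  Then:

* every non-empty locally closed (in particular every non-empty open) subset of `X` contains the image of a
  `K`-point `t : Spec K → X` with `t ≫ f = 𝟙` (`exists_comp_eq_id_and_base_mem_of_isLocallyClosed`,
  `exists_comp_eq_id_and_base_mem_of_isOpen`): `X` is Jacobson (Mathlib `LocallyOfFiniteType.jacobsonSpace`), so the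
  subset contains a closed point (Mathlib `nonempty_inter_closedPoints` — «closed points are very dense»,
  [Görtz–Wedhorn, Prop. 3.35]), and over an algebraically closed field a closed point of a scheme locally of finite
  type is the image of a `K`-point (Mathlib `pointOfClosedPoint`, Hilbert's Nullstellensatz, [Görtz–Wedhorn, Cor. 3.36]);
* every connected component of `X` contains the image of a `K`-point (`exists_comp_eq_id_and_base_mem_connectedComponent`,
  `exists_base_closedPoint_mem_connectedComponent`): `X` is locally Noetherian (Mathlib
  `LocallyOfFiniteType.isLocallyNoetherian`), so its connected components are open
  (`isOpen_connectedComponent_of_isLocallyNoetherian`, [Stacks, Tag 04MF]).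

The last form is the raw binder `hpt : ∀ s : S, ∃ t : Spec (.of Ω₀) ⟶ S, t.base (IsLocalRing.closedPoint Ω₀) ∈
connectedComponent s` of `AbelianSchemes/PoincarePullbackSliceSpread` (cell hodgecm-mathlib, HECKE-LINK D6 (K), spread
step), discharged for every base `S` locally of finite type over an algebraically closed field `Ω₀` (e.g. `Ω₀ = ℂ`).
Theorems only, Mathlib + one tree leaf.

References: U. Görtz, T. Wedhorn, *Algebraic Geometry I* (2nd ed. 2020), Prop. 3.35 and Cor. 3.36 [GortzWedhorn2020];
The Stacks Project, Tag 04MF [StacksProject].  HC_CM is proved only modulo the 7 printed citations until rung 0 closes;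
count-neutral generic leaf.
-/

universe u

open CategoryTheory AlgebraicGeometry Topology

namespace Literature.AlgebraicGeometry.Morphisms

variable {X : Scheme.{u}} {K : Type u} [Field K] [IsAlgClosed K] (f : X ⟶ Spec (.of K)) [LocallyOfFiniteType f]

/-- Over an algebraically closed field `K`, every non-empty locally closed subset `Z` of a scheme `X` locally of
finite type over `K` contains the image of a `K`-point: there is a section `t : Spec K → X` of the structure
morphism (`t ≫ f = 𝟙`) whose image lies in `Z` (closed points are very dense, and closed points are `K`-points).
[cite: GortzWedhorn2020, Prop. 3.35 and Cor. 3.36] -/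
theorem exists_comp_eq_id_and_base_mem_of_isLocallyClosed {Z : Set X} (hZ : IsLocallyClosed Z) (hne : Z.Nonempty) :
    ∃ t : Spec (.of K) ⟶ X, t ≫ f = 𝟙 _ ∧ t.base (IsLocalRing.closedPoint K) ∈ Z := by
  haveI : JacobsonSpace X := LocallyOfFiniteType.jacobsonSpace f
  obtain ⟨x, hxZ, hxc⟩ := nonempty_inter_closedPoints hne hZ
  refine ⟨pointOfClosedPoint f x (mem_closedPoints_iff.mp hxc), pointOfClosedPoint_comp f x _, ?_⟩
  have h : (pointOfClosedPoint f x (mem_closedPoints_iff.mp hxc)).base (IsLocalRing.closedPoint K) = x :=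
    pointOfClosedPoint_apply f x _ _
  rw [h]
  exact hxZ

/-- Over an algebraically closed field `K`, every non-empty open subset of a scheme locally of finite type over `K`
contains the image of a `K`-point `t` with `t ≫ f = 𝟙`. [cite: GortzWedhorn2020, Prop. 3.35 and Cor. 3.36] -/
theorem exists_comp_eq_id_and_base_mem_of_isOpen {U : Set X} (hU : IsOpen U) (hne : U.Nonempty) :
    ∃ t : Spec (.of K) ⟶ X, t ≫ f = 𝟙 _ ∧ t.base (IsLocalRing.closedPoint K) ∈ U :=
  exists_comp_eq_id_and_base_mem_of_isLocallyClosed f hU.isLocallyClosed hne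

/-- Over an algebraically closed field `K`, every connected component of a scheme `X` locally of finite type over
`K` contains the image of a `K`-point `t` with `t ≫ f = 𝟙`: `X` is locally Noetherian, so the component is open, and
non-empty opens have `K`-points. [cite: StacksProject, Tag 04MF] [cite: GortzWedhorn2020, Prop. 3.35 and Cor. 3.36] -/
theorem exists_comp_eq_id_and_base_mem_connectedComponent (s : X) :
    ∃ t : Spec (.of K) ⟶ X, t ≫ f = 𝟙 _ ∧ t.base (IsLocalRing.closedPoint K) ∈ connectedComponent s := by
  haveI : IsLocallyNoetherian X := LocallyOfFiniteType.isLocallyNoetherian f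
  exact exists_comp_eq_id_and_base_mem_of_isOpen f (isOpen_connectedComponent_of_isLocallyNoetherian X s)
    ⟨s, mem_connectedComponent⟩

include f in
/-- **Every connected component has a rational point** (the form consumed as the binder `hpt` of
`AbelianSchemes/PoincarePullbackSliceSpread`): for `X` locally of finite type over an algebraically closed field
`K` and every `s ∈ X` there is a `K`-point `t : Spec K → X` whose image lies in the connected component of `s`.
[cite: StacksProject, Tag 04MF] [cite: GortzWedhorn2020, Prop. 3.35 and Cor. 3.36] -/
theorem exists_base_closedPoint_mem_connectedComponent (s : X) :
    ∃ t : Spec (.of K) ⟶ X, t.base (IsLocalRing.closedPoint K) ∈ connectedComponent s := by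
  obtain ⟨t, -, ht⟩ := exists_comp_eq_id_and_base_mem_connectedComponent f s
  exact ⟨t, ht⟩

end Literature.AlgebraicGeometry.Morphisms
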